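import Summits.Ventures.AbcSig.Rows.Bridge
import Summits.Ventures.AbcSig.Rows.C2aL179A3S
import Summits.Ventures.AbcSig.Rows.C2aL179A3SAB

/-!
# Venture AbcSig — CELL `C2aL179A3S`: the census statement `Rows.C2aCellRed 179 (fun a => a = 3) {11}` from the two row theorems

HONEST FRAMING. COMPUTATION cell `pub-abcsig`; CONDITIONAL theorem; no claim on ABC or any summit. Hypotheses exactly as in
`Rows/C2aL179A3S.lean` and `Rows/C2aL179A3SAB.lean`: `BS04Package` (CITED), `DataComplete` / `RefinesCPSymAll` (COMPUTED, certified level files;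
norm-form certificates), and the rows' per-orbit CITED exclusions universally quantified in the exponent
(suffix `_d1` for `famB`, `_d2` for `famAB`). Conclusion = p1's census predicate (`Rows/Statements.lean`) with the residual of the row of
record `census/rows/C2a/C2a-l179-a3.md` (sha16 `e4b425d76e9d7d34`): all four coprime distributions `A·B = 2^3·179^m`, reduced exponents.
GENERATED by p-lean g5 `gen5/c2arow4.py` (pattern of `Rows/C2aL277A0XCell.lean`).
-/

namespace Summit.Ventures.AbcSig

/-- Cell `C2aL179A3S`: `Rows.C2aCellRed 179 (fun a => a = 3) {11}` under the rows' hypotheses. -/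
theorem xcell_C2aL179A3S (M : NewformModel) (hP : M.BS04Package)
    (hRB_orbit_5728_9 : ∀ f : M.Form 5728, M.Matches f orbit_5728_9 → M.Matches f rb_5728_9)
    (hRB_orbit_5728_10 : ∀ f : M.Form 5728, M.Matches f orbit_5728_10 → M.Matches f rb_5728_10)
    (hD5728 : M.DataComplete 5728 level5728Orbits)
    (hD358 : M.DataComplete 358 level358Orbits) :
    Rows.C2aCellRed 179 (fun a => a = 3) {11} :=
  C2aCellRed_of_rows 179 (by norm_num) (by norm_num) _ _
    (fun n hn h11 hnℓ hR a m (ha : a = 3) han hm hmn x y z h1 h2 => by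
      subst ha
      exact xrow_C2aL179A3S M hP hRB_orbit_5728_9 hRB_orbit_5728_10 hD5728 hD358 n hn h11 hnℓ (by simpa using hR) m hm hmn  x y z h1 h2)
    (fun n hn h11 hnℓ hR a m (ha : a = 3) han hm hmn x y z h1 h2 => by
      subst ha
      exact xrow_C2aL179A3SAB M hP hRB_orbit_5728_9 hRB_orbit_5728_10 hD5728 hD358 n hn h11 hnℓ (by simpa using hR) m hm hmn  x y z h1 h2)

end Summit.Ventures.AbcSig
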